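import Literature.RepresentationTheory.TwistedCoinvariants
import Mathlib.RepresentationTheory.Basic
import Mathlib.GroupTheory.NoncommCoprod
import Mathlib.RingTheory.Flat.Basic
import HarnessLib

/-!
# Twisted coinvariants of outer tensor products and of commuting pairs

Topic `RepresentationTheory`; namespace `Literature.RepresentationTheory.TwistedCoinv`.  KERNEL only (four small
definitions with bodies — the outer tensor character / representation and the two comparison equivalences — and
theorems; no named fact, no `sorry`).  Companion of `TwistedCoinvariants.lean` (`Coinv ρW χ = S ⧸ span{ρW h v − χ h v}`,
`mk`, `lift`, `rep`).

The bookkeeping behind «the `(χ₁, χ₂)`-coinvariants of `V₁ ⊗ V₂` under `H₁ × H₂` acting factorwise are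
`(V₁)_{χ₁} ⊗ (V₂)_{χ₂}`» (right exactness of coinvariants, [BernsteinZelevinsky1976, §2.30–2.35]; outer tensor
products [GoodmanWallach2009, §4.2.1]):

* §1 `boxChar χ₁ χ₂ : H₁ × H₂ →* kˣ` (`(h₁,h₂) ↦ χ₁ h₁ · χ₂ h₂`), `boxRep ρ₁ ρ₂ : Representation k (H₁ × H₂) (V₁ ⊗ V₂)`
  (`(h₁,h₂) ↦ ρ₁ h₁ ⊗ ρ₂ h₂`, Mathlib `Representation.tprod` along the two projections);
* §2 **`coinvTensorEquiv : Coinv (boxRep ρ₁ ρ₂) (boxChar χ₁ χ₂) ≃ₗ[k] Coinv ρ₁ χ₁ ⊗[k] Coinv ρ₂ χ₂`**,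
  `mk (v₁ ⊗ₜ v₂) ↦ mk v₁ ⊗ₜ mk v₂` (any commutative ring `k`);
* §3 for a COMMUTING pair `ρV : G → GL(S)`, `ρW : H → GL(S)`: `pairRep ρV ρW hc : Representation k (G × H) S`
  (`(g,h) ↦ ρV g ∘ ρW h`, Mathlib `MonoidHom.noncommCoprod`) and **`coinvCoinvEquiv : Coinv (rep χ ρV hc) ξ ≃ₗ[k]
  Coinv (pairRep ρV ρW hc) (boxChar ξ χ)`** — the `ξ`-coinvariants under `G` of the `χ`-coinvariants under `H` are the
  `(ξ, χ)`-coinvariants under `G × H`;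
* §4 `ker_comp_mulEquiv` / `coinvCompEquiv` — re-indexing the acting group along an isomorphism `φ : H' ≃* H` does not
  change the coinvariants;
* §5 over a field: `nontrivial_tensor_iff : Nontrivial (M ⊗[k] N) ↔ Nontrivial M ∧ Nontrivial N`.

Consumer: the twist-rigidity programme for row IV-4c3 of the Hodge/COR-CM interface (restriction of a rank-one theta
lift to the unitary group of an anisotropic line: the `(χ, ξ)`-coinvariants of `ω_H ⊠ ω_L` under `Z × U(L)`).
HC_CM is NOT proved here.

## References
* I. N. Bernstein, A. V. Zelevinsky, *Representations of the group GL(n,F) where F is a non-archimedean local field*,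
  Russian Math. Surveys 31 (1976), §2.30–2.35 (coinvariants, exactness) [BernsteinZelevinsky1976].
* R. Goodman, N. Wallach, *Symmetry, Representations, and Invariants*, GTM 255 (2009), §4.2.1 (outer tensor products)
  [GoodmanWallach2009].
-/

set_option autoImplicit false

noncomputable section

open scoped TensorProduct

namespace Literature.RepresentationTheory.TwistedCoinv

/-! ## §1 Outer tensor character and representation -/

section Box

variable {k : Type*} [CommRing k] {H₁ H₂ V₁ V₂ : Type*} [Group H₁] [Group H₂]
  [AddCommGroup V₁] [Module k V₁] [AddCommGroup V₂] [Module k V₂]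
  (ρ₁ : Representation k H₁ V₁) (ρ₂ : Representation k H₂ V₂) (χ₁ : H₁ →* kˣ) (χ₂ : H₂ →* kˣ)

/-- The outer tensor character `(h₁, h₂) ↦ χ₁ h₁ · χ₂ h₂` of `H₁ × H₂`. [cite: GoodmanWallach2009, §4.2.1] -/
def boxChar : H₁ × H₂ →* kˣ :=
  (χ₁.comp (MonoidHom.fst H₁ H₂)) * (χ₂.comp (MonoidHom.snd H₁ H₂))

/-- `boxChar χ₁ χ₂ (h₁, h₂) = χ₁ h₁ * χ₂ h₂`. [cite: GoodmanWallach2009, §4.2.1] -/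
@[simp] theorem boxChar_apply (h : H₁ × H₂) : boxChar χ₁ χ₂ h = χ₁ h.1 * χ₂ h.2 := rfl

/-- The outer tensor representation `(h₁, h₂) ↦ ρ₁ h₁ ⊗ ρ₂ h₂` of `H₁ × H₂` on `V₁ ⊗ V₂`.
[cite: GoodmanWallach2009, §4.2.1] -/
def boxRep : Representation k (H₁ × H₂) (V₁ ⊗[k] V₂) :=
  Representation.tprod (ρ₁.comp (MonoidHom.fst H₁ H₂)) (ρ₂.comp (MonoidHom.snd H₁ H₂))

/-- `boxRep ρ₁ ρ₂ (h₁, h₂) = ρ₁ h₁ ⊗ ρ₂ h₂` as a map. [cite: GoodmanWallach2009, §4.2.1] -/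
theorem boxRep_apply (h : H₁ × H₂) : boxRep ρ₁ ρ₂ h = TensorProduct.map (ρ₁ h.1) (ρ₂ h.2) := rfl

/-- `boxRep ρ₁ ρ₂ (h₁, h₂) (v₁ ⊗ v₂) = ρ₁ h₁ v₁ ⊗ ρ₂ h₂ v₂`. [cite: GoodmanWallach2009, §4.2.1] -/
@[simp] theorem boxRep_apply_tmul (h : H₁ × H₂) (v₁ : V₁) (v₂ : V₂) :
    boxRep ρ₁ ρ₂ h (v₁ ⊗ₜ v₂) = ρ₁ h.1 v₁ ⊗ₜ ρ₂ h.2 v₂ := rfl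

/-! ## §2 Coinvariants of an outer tensor product -/

/-- the forward comparison map `mk (v₁ ⊗ v₂) ↦ mk v₁ ⊗ mk v₂`. [cite: BernsteinZelevinsky1976, §2.30–2.35] -/
def coinvTensorTo : Coinv (boxRep ρ₁ ρ₂) (boxChar χ₁ χ₂) →ₗ[k] Coinv ρ₁ χ₁ ⊗[k] Coinv ρ₂ χ₂ :=
  lift (boxRep ρ₁ ρ₂) (boxChar χ₁ χ₂) (TensorProduct.map (mk ρ₁ χ₁) (mk ρ₂ χ₂)) fun h x => by
    induction x using TensorProduct.induction_on with
    | zero => rw [map_zero, map_zero, smul_zero]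
    | tmul v₁ v₂ =>
        rw [boxRep_apply_tmul, TensorProduct.map_tmul, TensorProduct.map_tmul, mk_ρW, mk_ρW,
          TensorProduct.smul_tmul_smul, boxChar_apply, Units.val_mul]
    | add x y hx hy => rw [map_add, map_add, hx, hy, map_add, smul_add]

/-- `coinvTensorTo (mk (v₁ ⊗ v₂)) = mk v₁ ⊗ mk v₂`. [cite: BernsteinZelevinsky1976, §2.30–2.35] -/
@[simp] theorem coinvTensorTo_mk_tmul (v₁ : V₁) (v₂ : V₂) :
    coinvTensorTo ρ₁ ρ₂ χ₁ χ₂ (mk (boxRep ρ₁ ρ₂) (boxChar χ₁ χ₂) (v₁ ⊗ₜ v₂)) = mk ρ₁ χ₁ v₁ ⊗ₜ mk ρ₂ χ₂ v₂ := by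
  rw [coinvTensorTo, ← LinearMap.comp_apply, lift_comp_mk, TensorProduct.map_tmul]

/-- the bilinear map `(v₁, v₂) ↦ mk (v₁ ⊗ v₂)` into the coinvariants of the outer tensor product.
[cite: BernsteinZelevinsky1976, §2.30–2.35] -/
private def boxMk : V₁ →ₗ[k] V₂ →ₗ[k] Coinv (boxRep ρ₁ ρ₂) (boxChar χ₁ χ₂) :=
  (TensorProduct.mk k V₁ V₂).compr₂ (mk (boxRep ρ₁ ρ₂) (boxChar χ₁ χ₂))

/-- `boxMk v₁ v₂ = mk (v₁ ⊗ v₂)` (definitional). [folklore] -/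
private theorem boxMk_apply (v₁ : V₁) (v₂ : V₂) :
    boxMk ρ₁ ρ₂ χ₁ χ₂ v₁ v₂ = mk (boxRep ρ₁ ρ₂) (boxChar χ₁ χ₂) (v₁ ⊗ₜ v₂) := rfl

/-- a relation of the second factor dies in the coinvariants of the outer tensor product.
[cite: BernsteinZelevinsky1976, §2.30–2.35] -/
private theorem boxMk_right_rel (v₁ : V₁) (h₂ : H₂) (v₂ : V₂) :
    boxMk ρ₁ ρ₂ χ₁ χ₂ v₁ (ρ₂ h₂ v₂ - ((χ₂ h₂ : kˣ) : k) • v₂) = 0 := by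
  rw [map_sub, map_smul, boxMk_apply, boxMk_apply]
  have h := mk_ρW (boxRep ρ₁ ρ₂) (boxChar χ₁ χ₂) ((1 : H₁), h₂) (v₁ ⊗ₜ v₂)
  rw [boxRep_apply_tmul, map_one, Module.End.one_apply, boxChar_apply, map_one, one_mul] at h
  rw [h, sub_self]

/-- a relation of the first factor dies in the coinvariants of the outer tensor product.
[cite: BernsteinZelevinsky1976, §2.30–2.35] -/
private theorem boxMk_left_rel (h₁ : H₁) (v₁ : V₁) (v₂ : V₂) :
    boxMk ρ₁ ρ₂ χ₁ χ₂ (ρ₁ h₁ v₁ - ((χ₁ h₁ : kˣ) : k) • v₁) v₂ = 0 := by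
  rw [map_sub, map_smul, LinearMap.sub_apply, LinearMap.smul_apply, boxMk_apply, boxMk_apply]
  have h := mk_ρW (boxRep ρ₁ ρ₂) (boxChar χ₁ χ₂) (h₁, (1 : H₂)) (v₁ ⊗ₜ v₂)
  rw [boxRep_apply_tmul, map_one, Module.End.one_apply, boxChar_apply, map_one, mul_one] at h
  rw [h, sub_self]

/-- `boxMk` descended in the second variable: `V₁ →ₗ (Coinv ρ₂ χ₂ →ₗ Coinv box)`.
[cite: BernsteinZelevinsky1976, §2.30–2.35] -/
private def boxMk₂ : V₁ →ₗ[k] Coinv ρ₂ χ₂ →ₗ[k] Coinv (boxRep ρ₁ ρ₂) (boxChar χ₁ χ₂) :=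
  (((ker ρ₂ χ₂).liftQ (boxMk ρ₁ ρ₂ χ₁ χ₂).flip (by
      rw [ker, Submodule.span_le]
      rintro _ ⟨⟨h₂, v₂⟩, rfl⟩
      rw [SetLike.mem_coe, LinearMap.mem_ker]
      ext v₁
      rw [LinearMap.flip_apply, LinearMap.zero_apply]
      exact boxMk_right_rel ρ₁ ρ₂ χ₁ χ₂ v₁ h₂ v₂)).flip)

/-- `boxMk₂ v₁ (mk v₂) = mk (v₁ ⊗ v₂)` (definitional). [folklore] -/
private theorem boxMk₂_apply_mk (v₁ : V₁) (v₂ : V₂) :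
    boxMk₂ ρ₁ ρ₂ χ₁ χ₂ v₁ (mk ρ₂ χ₂ v₂) = mk (boxRep ρ₁ ρ₂) (boxChar χ₁ χ₂) (v₁ ⊗ₜ v₂) := rfl

/-- `boxMk` descended in both variables: `Coinv ρ₁ χ₁ →ₗ (Coinv ρ₂ χ₂ →ₗ Coinv box)`.
[cite: BernsteinZelevinsky1976, §2.30–2.35] -/
private def boxMk₁₂ : Coinv ρ₁ χ₁ →ₗ[k] Coinv ρ₂ χ₂ →ₗ[k] Coinv (boxRep ρ₁ ρ₂) (boxChar χ₁ χ₂) :=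
  (ker ρ₁ χ₁).liftQ (boxMk₂ ρ₁ ρ₂ χ₁ χ₂) (by
    rw [ker, Submodule.span_le]
    rintro _ ⟨⟨h₁, v₁⟩, rfl⟩
    rw [SetLike.mem_coe, LinearMap.mem_ker]
    refine ext_mk ρ₂ χ₂ fun v₂ => ?_
    rw [boxMk₂_apply_mk, LinearMap.zero_apply]
    exact boxMk_left_rel ρ₁ ρ₂ χ₁ χ₂ h₁ v₁ v₂)

/-- `boxMk₁₂ (mk v₁) (mk v₂) = mk (v₁ ⊗ v₂)` (definitional). [folklore] -/
private theorem boxMk₁₂_apply_mk_mk (v₁ : V₁) (v₂ : V₂) :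
    boxMk₁₂ ρ₁ ρ₂ χ₁ χ₂ (mk ρ₁ χ₁ v₁) (mk ρ₂ χ₂ v₂) = mk (boxRep ρ₁ ρ₂) (boxChar χ₁ χ₂) (v₁ ⊗ₜ v₂) := rfl

/-- the backward comparison map `mk v₁ ⊗ mk v₂ ↦ mk (v₁ ⊗ v₂)`. [cite: BernsteinZelevinsky1976, §2.30–2.35] -/
def coinvTensorOf : Coinv ρ₁ χ₁ ⊗[k] Coinv ρ₂ χ₂ →ₗ[k] Coinv (boxRep ρ₁ ρ₂) (boxChar χ₁ χ₂) :=
  TensorProduct.lift (boxMk₁₂ ρ₁ ρ₂ χ₁ χ₂)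

/-- `coinvTensorOf (mk v₁ ⊗ mk v₂) = mk (v₁ ⊗ v₂)`. [cite: BernsteinZelevinsky1976, §2.30–2.35] -/
@[simp] theorem coinvTensorOf_tmul_mk (v₁ : V₁) (v₂ : V₂) :
    coinvTensorOf ρ₁ ρ₂ χ₁ χ₂ (mk ρ₁ χ₁ v₁ ⊗ₜ mk ρ₂ χ₂ v₂) = mk (boxRep ρ₁ ρ₂) (boxChar χ₁ χ₂) (v₁ ⊗ₜ v₂) := by
  rw [coinvTensorOf, TensorProduct.lift.tmul, boxMk₁₂_apply_mk_mk]

/-- **Coinvariants of an outer tensor product**: `(V₁ ⊗ V₂)_{(H₁×H₂, χ₁⊠χ₂)} ≃ (V₁)_{(H₁,χ₁)} ⊗ (V₂)_{(H₂,χ₂)}`,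
`mk (v₁ ⊗ v₂) ↦ mk v₁ ⊗ mk v₂` (any commutative coefficient ring). [cite: BernsteinZelevinsky1976, §2.30–2.35] -/
def coinvTensorEquiv : Coinv (boxRep ρ₁ ρ₂) (boxChar χ₁ χ₂) ≃ₗ[k] Coinv ρ₁ χ₁ ⊗[k] Coinv ρ₂ χ₂ :=
  LinearEquiv.ofLinear (coinvTensorTo ρ₁ ρ₂ χ₁ χ₂) (coinvTensorOf ρ₁ ρ₂ χ₁ χ₂)
    (TensorProduct.ext' fun x y => by
      obtain ⟨v₁, rfl⟩ := mk_surjective ρ₁ χ₁ x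
      obtain ⟨v₂, rfl⟩ := mk_surjective ρ₂ χ₂ y
      rw [LinearMap.comp_apply, coinvTensorOf_tmul_mk, coinvTensorTo_mk_tmul, LinearMap.id_apply])
    (ext_mk _ _ fun x => by
      rw [LinearMap.comp_apply, LinearMap.id_apply]
      induction x using TensorProduct.induction_on with
      | zero => rw [map_zero, map_zero, map_zero]
      | tmul v₁ v₂ => rw [coinvTensorTo_mk_tmul, coinvTensorOf_tmul_mk]
      | add x y hx hy => rw [map_add, map_add, map_add, hx, hy])

/-- `coinvTensorEquiv (mk (v₁ ⊗ v₂)) = mk v₁ ⊗ mk v₂`. [cite: BernsteinZelevinsky1976, §2.30–2.35] -/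
@[simp] theorem coinvTensorEquiv_mk_tmul (v₁ : V₁) (v₂ : V₂) :
    coinvTensorEquiv ρ₁ ρ₂ χ₁ χ₂ (mk (boxRep ρ₁ ρ₂) (boxChar χ₁ χ₂) (v₁ ⊗ₜ v₂)) = mk ρ₁ χ₁ v₁ ⊗ₜ mk ρ₂ χ₂ v₂ :=
  coinvTensorTo_mk_tmul ρ₁ ρ₂ χ₁ χ₂ v₁ v₂

/-- `coinvTensorEquiv.symm (mk v₁ ⊗ mk v₂) = mk (v₁ ⊗ v₂)`. [cite: BernsteinZelevinsky1976, §2.30–2.35] -/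
@[simp] theorem coinvTensorEquiv_symm_tmul_mk (v₁ : V₁) (v₂ : V₂) :
    (coinvTensorEquiv ρ₁ ρ₂ χ₁ χ₂).symm (mk ρ₁ χ₁ v₁ ⊗ₜ mk ρ₂ χ₂ v₂) =
      mk (boxRep ρ₁ ρ₂) (boxChar χ₁ χ₂) (v₁ ⊗ₜ v₂) :=
  coinvTensorOf_tmul_mk ρ₁ ρ₂ χ₁ χ₂ v₁ v₂

end Box

/-! ## §3 Iterated coinvariants of a commuting pair -/

section Pair

variable {k : Type*} [CommRing k] {G H S : Type*} [Group G] [Group H] [AddCommGroup S] [Module k S]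
  (ρV : Representation k G S) (ρW : Representation k H S) (hc : ∀ (g : G) (h : H), Commute (ρV g) (ρW h))
  (ξ : G →* kˣ) (χ : H →* kˣ)

/-- The representation `(g, h) ↦ ρV g ∘ ρW h` of `G × H` defined by a commuting pair.
[cite: BernsteinZelevinsky1976, §2.30–2.35] -/
def pairRep : Representation k (G × H) S := MonoidHom.noncommCoprod ρV ρW hc

/-- `pairRep ρV ρW hc (g, h) v = ρV g (ρW h v)`. [cite: BernsteinZelevinsky1976, §2.30–2.35] -/
@[simp] theorem pairRep_apply (gh : G × H) (v : S) : pairRep ρV ρW hc gh v = ρV gh.1 (ρW gh.2 v) := rfl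

/-- the `χ`-coinvariants under `H` map to the `(ξ, χ)`-coinvariants under `G × H`.
[cite: BernsteinZelevinsky1976, §2.30–2.35] -/
def coinvToPair : Coinv ρW χ →ₗ[k] Coinv (pairRep ρV ρW hc) (boxChar ξ χ) :=
  lift ρW χ (mk (pairRep ρV ρW hc) (boxChar ξ χ)) fun h v => by
    have e := mk_ρW (pairRep ρV ρW hc) (boxChar ξ χ) ((1 : G), h) v
    rwa [pairRep_apply, map_one, Module.End.one_apply, boxChar_apply, map_one, one_mul] at e

/-- `coinvToPair (mk v) = mk v`. [cite: BernsteinZelevinsky1976, §2.30–2.35] -/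
@[simp] theorem coinvToPair_mk (v : S) :
    coinvToPair ρV ρW hc ξ χ (mk ρW χ v) = mk (pairRep ρV ρW hc) (boxChar ξ χ) v := by
  rw [coinvToPair, ← LinearMap.comp_apply, lift_comp_mk]

/-- forward: `mk_ξ (mk_χ v) ↦ mk_{(ξ,χ)} v`. [cite: BernsteinZelevinsky1976, §2.30–2.35] -/
def coinvCoinvTo : Coinv (rep χ ρV hc) ξ →ₗ[k] Coinv (pairRep ρV ρW hc) (boxChar ξ χ) :=
  lift (rep χ ρV hc) ξ (coinvToPair ρV ρW hc ξ χ) fun g x => by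
    obtain ⟨v, rfl⟩ := mk_surjective ρW χ x
    rw [rep_mk, coinvToPair_mk, coinvToPair_mk]
    have e := mk_ρW (pairRep ρV ρW hc) (boxChar ξ χ) (g, (1 : H)) v
    rwa [pairRep_apply, map_one, Module.End.one_apply, boxChar_apply, map_one, mul_one] at e

/-- `coinvCoinvTo (mk (mk v)) = mk v`. [cite: BernsteinZelevinsky1976, §2.30–2.35] -/
@[simp] theorem coinvCoinvTo_mk_mk (v : S) :
    coinvCoinvTo ρV ρW hc ξ χ (mk (rep χ ρV hc) ξ (mk ρW χ v)) = mk (pairRep ρV ρW hc) (boxChar ξ χ) v := by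
  rw [coinvCoinvTo, ← LinearMap.comp_apply, lift_comp_mk, coinvToPair_mk]

/-- backward: `mk_{(ξ,χ)} v ↦ mk_ξ (mk_χ v)`. [cite: BernsteinZelevinsky1976, §2.30–2.35] -/
def coinvCoinvOf : Coinv (pairRep ρV ρW hc) (boxChar ξ χ) →ₗ[k] Coinv (rep χ ρV hc) ξ :=
  lift (pairRep ρV ρW hc) (boxChar ξ χ) (mk (rep χ ρV hc) ξ ∘ₗ mk ρW χ) fun gh v => by
    rw [LinearMap.comp_apply, LinearMap.comp_apply, pairRep_apply, mk_ρV_ρW χ ρV hc, map_smul, mk_ρW, smul_smul,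
      boxChar_apply, Units.val_mul, mul_comm]

/-- `coinvCoinvOf (mk v) = mk (mk v)`. [cite: BernsteinZelevinsky1976, §2.30–2.35] -/
@[simp] theorem coinvCoinvOf_mk (v : S) :
    coinvCoinvOf ρV ρW hc ξ χ (mk (pairRep ρV ρW hc) (boxChar ξ χ) v) = mk (rep χ ρV hc) ξ (mk ρW χ v) := by
  rw [coinvCoinvOf, ← LinearMap.comp_apply, lift_comp_mk, LinearMap.comp_apply]

/-- **Iterated coinvariants**: for a commuting pair, the `ξ`-coinvariants under `G` of the `χ`-coinvariants under `H`
are the `(ξ, χ)`-coinvariants under `G × H`: `Coinv (rep χ ρV hc) ξ ≃ Coinv (pairRep ρV ρW hc) (ξ ⊠ χ)`.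
[cite: BernsteinZelevinsky1976, §2.30–2.35] -/
def coinvCoinvEquiv : Coinv (rep χ ρV hc) ξ ≃ₗ[k] Coinv (pairRep ρV ρW hc) (boxChar ξ χ) :=
  LinearEquiv.ofLinear (coinvCoinvTo ρV ρW hc ξ χ) (coinvCoinvOf ρV ρW hc ξ χ)
    (ext_mk _ _ fun v => by
      rw [LinearMap.comp_apply, coinvCoinvOf_mk, coinvCoinvTo_mk_mk, LinearMap.id_apply])
    (ext_mk _ _ fun x => by
      obtain ⟨v, rfl⟩ := mk_surjective ρW χ x
      rw [LinearMap.comp_apply, coinvCoinvTo_mk_mk, coinvCoinvOf_mk, LinearMap.id_apply])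

/-- `coinvCoinvEquiv (mk (mk v)) = mk v`. [cite: BernsteinZelevinsky1976, §2.30–2.35] -/
@[simp] theorem coinvCoinvEquiv_mk_mk (v : S) :
    coinvCoinvEquiv ρV ρW hc ξ χ (mk (rep χ ρV hc) ξ (mk ρW χ v)) = mk (pairRep ρV ρW hc) (boxChar ξ χ) v :=
  coinvCoinvTo_mk_mk ρV ρW hc ξ χ v

/-- `coinvCoinvEquiv.symm (mk v) = mk (mk v)`. [cite: BernsteinZelevinsky1976, §2.30–2.35] -/
@[simp] theorem coinvCoinvEquiv_symm_mk (v : S) :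
    (coinvCoinvEquiv ρV ρW hc ξ χ).symm (mk (pairRep ρV ρW hc) (boxChar ξ χ) v) =
      mk (rep χ ρV hc) ξ (mk ρW χ v) :=
  coinvCoinvOf_mk ρV ρW hc ξ χ v

end Pair

/-! ## §4 Re-indexing the acting group along an isomorphism -/

section Reindex

variable {k : Type*} [CommRing k] {H H' S : Type*} [Group H] [Group H'] [AddCommGroup S] [Module k S]
  (ρW : Representation k H S) (χ : H →* kˣ) (φ : H' ≃* H)

/-- The relation submodule is unchanged by re-indexing the acting group along an isomorphism `φ : H' ≃* H`.
[cite: BernsteinZelevinsky1976, §2.30–2.35] -/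
theorem ker_comp_mulEquiv : ker (ρW.comp φ.toMonoidHom) (χ.comp φ.toMonoidHom) = ker ρW χ := by
  refine le_antisymm ?_ ?_
  · rw [ker, Submodule.span_le]
    rintro _ ⟨⟨h', v⟩, rfl⟩
    exact sub_mem_ker ρW χ (φ h') v
  · rw [ker, Submodule.span_le]
    rintro _ ⟨⟨h, v⟩, rfl⟩
    have e := sub_mem_ker (ρW.comp φ.toMonoidHom) (χ.comp φ.toMonoidHom) (φ.symm h) v
    rwa [MonoidHom.comp_apply, MonoidHom.comp_apply, MulEquiv.coe_toMonoidHom, MulEquiv.apply_symm_apply] at e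

/-- **Re-indexing**: `Coinv (ρW ∘ φ) (χ ∘ φ) ≃ Coinv ρW χ` for an isomorphism `φ : H' ≃* H` of acting groups (the
identity on representatives). [cite: BernsteinZelevinsky1976, §2.30–2.35] -/
def coinvCompEquiv : Coinv (ρW.comp φ.toMonoidHom) (χ.comp φ.toMonoidHom) ≃ₗ[k] Coinv ρW χ :=
  Submodule.quotEquivOfEq _ _ (ker_comp_mulEquiv ρW χ φ)

/-- `coinvCompEquiv (mk v) = mk v`. [cite: BernsteinZelevinsky1976, §2.30–2.35] -/
@[simp] theorem coinvCompEquiv_mk (v : S) :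
    coinvCompEquiv ρW χ φ (mk (ρW.comp φ.toMonoidHom) (χ.comp φ.toMonoidHom) v) = mk ρW χ v := rfl

end Reindex

/-! ## §5 Non-vanishing of a tensor product over a field -/

section Field

variable {k : Type*} [Field k] {M N : Type*} [AddCommGroup M] [Module k M] [AddCommGroup N] [Module k N]

/-- Over a field, `M ⊗ N ≠ 0` iff `M ≠ 0` and `N ≠ 0`. [cite: GoodmanWallach2009, §4.2.1] -/
theorem nontrivial_tensor_iff : Nontrivial (M ⊗[k] N) ↔ Nontrivial M ∧ Nontrivial N := by
  refine ⟨fun h => ⟨?_, ?_⟩, fun ⟨hM, hN⟩ => ?_⟩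
  · by_contra hM
    rw [not_nontrivial_iff_subsingleton] at hM
    exact not_subsingleton (M ⊗[k] N) inferInstance
  · by_contra hN
    rw [not_nontrivial_iff_subsingleton] at hN
    exact not_subsingleton (M ⊗[k] N) inferInstance
  · obtain ⟨m, hm⟩ := exists_ne (0 : M)
    have hinj : Function.Injective (LinearMap.toSpanSingleton k M m) :=
      LinearMap.ker_eq_bot.1 (LinearMap.ker_toSpanSingleton k hm)
    exact TensorProduct.nontrivial_of_linearMap_injective_of_flat_right k M N _ hinj

/-- Over a field, `x ⊗ y`-free form: `M ⊗ N` is trivial iff one factor is. [cite: GoodmanWallach2009, §4.2.1] -/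
theorem subsingleton_tensor_iff : Subsingleton (M ⊗[k] N) ↔ Subsingleton M ∨ Subsingleton N := by
  rw [← not_iff_not, not_or, ← not_nontrivial_iff_subsingleton.not, ← not_nontrivial_iff_subsingleton.not,
    ← not_nontrivial_iff_subsingleton.not, not_not, not_not, not_not]
  exact nontrivial_tensor_iff

end Field

end Literature.RepresentationTheory.TwistedCoinv

end
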